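import Summits.BirchSwinnertonDyer.BirchSwinnertonDyer.Theorems.SelmerRankSelmerRankLBStubDeltaParityLemmas
import HarnessLib

/-!
# Crux `SelmerRankLB` (stmt-BirchSwinnertonDyer-0131), line `kurihara_order`, stub V1
# `stub_delta_parity` — algebraic lemmas II (Mazur–Tate norm relation, incomplete Kurihara sums)

Second support file for `SelmerRankSelmerRankLBStubDeltaParity`. PURE ALGEBRA for an arbitrary
`f ∈ S₂(Γ₀(N))`, with the analytic inputs as hypotheses: `p`-integrality of the rational plus
symbols `[z/m]⁺_f` and the Hecke relation `a_ℓ [r]⁺ = Σ_{j<ℓ} [(r+j)/ℓ]⁺ + [ℓ r]⁺` at a prime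
`ℓ` (tree theorem `intCast_mul_ratPlusSymbol`, a hypothesis here) with `a_ℓ ≡ 2 (mod p^k)`.
(1) The NORM RELATION of Mazur–Tate 1987, §1.3, for the plus symbols,
`Σ_{a ∈ (ℤ/m'ℓ)ˣ, a ≡ b (m')} [a/m'ℓ]⁺ = a_ℓ [b/m']⁺ − [ℓb/m']⁺ − [ℓ⁻¹b/m']⁺`
(`deltaParity_sum_unitFiber_symbol`: sum the Hecke relation at `r = b/m'` over the fibre
`{b + m'j}` of `ℤ/m'ℓ → ℤ/m'` and remove its unique non-unit `ℓ·(ℓ⁻¹b)`); (2) the vanishing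
modulo `p^k` of the INCOMPLETE Kurihara sums
`D(m, S) = Σ_{a ∈ (ℤ/m)ˣ} \overline{[a/m]⁺} Π_{q ∈ S} Λ_q(a mod q)`, `S ⊊ primeFactors m`, `m ∣ n`
square-free (`deltaParity_incompleteSum_eq_zero`, registered as the sub-goal
`stub_delta_parity_incompleteSum_eq_zero`; Kim 2022, proof of Prop. 3.16: the image of the
Mazur–Tate element `θ_m` in `R[(ℤ/(m/ℓ))ˣ]` is `(a_ℓ − σ_ℓ − σ_ℓ⁻¹) θ_{m/ℓ}`), by strong
induction on `m` (`deltaParity_incompleteSum_mul`). No new definitions.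
References: Mazur–Tate, Duke Math. J. 54 (1987), §1.3, §1.6; C.-H. Kim, arXiv:2203.12159,
§3.5, Prop. 3.16; Mazur–Tate–Teitelbaum, Invent. Math. 84 (1986), §I.4 (4.2).
-/

noncomputable section

set_option linter.dupNamespace false

open scoped MatrixGroups ModularForm Classical

open CongruenceSubgroup Literature.NumberTheory.EllipticCurves
  Literature.NumberTheory.EllipticCurves.ModularForms

open Literature.NumberTheory.DiophantineGeometry.Dioph (ratModP)

namespace Summit.BirchSwinnertonDyer.BirchSwinnertonDyer.Theorems
/-! ### The norm relation (Mazur–Tate 1987, §1.3) -/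

section NormRelation

variable {p : ℕ} [Fact p.Prime] (k : ℕ) {N : ℕ} (f : CuspForm (Gamma0 N) 2)
  {m' ℓ : ℕ} [NeZero m'] [NeZero ℓ]

omit [Fact p.Prime] [NeZero ℓ] in
/-- `[z/m]⁺` only depends on `z mod m`: the symbol at the canonical representative of
`z mod m` is `[z/m]⁺` (`[r + 1]⁺ = [r]⁺`, `ratPlusSymbol_add_intCast_eq`). [folklore] -/
theorem deltaParity_symbol_natCast [NeZero N] {m : ℕ} [NeZero m] (z : ℕ) :
    ratPlusSymbol f ((((z : ZMod m).val : ℕ) : ℚ) / m) = ratPlusSymbol f ((z : ℚ) / m) := by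
  rw [ZMod.val_natCast]
  have hm : (m : ℚ) ≠ 0 := by exact_mod_cast NeZero.ne m
  have h1 : ((z % m : ℕ) : ℚ) = (z : ℚ) - (m : ℚ) * ((z / m : ℕ) : ℚ) := by
    rw [eq_sub_iff_add_eq]
    exact_mod_cast Nat.mod_add_div z m
  have h2 : ((z % m : ℕ) : ℚ) / m = (z : ℚ) / m + ((-((z / m : ℕ) : ℤ) : ℤ) : ℚ) := by
    rw [h1, Int.cast_neg, Int.cast_natCast]
    field_simp
    ring
  rw [h2, ratPlusSymbol_add_intCast_eq]

omit [Fact p.Prime] in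
/-- **Hecke relation summed over a fibre**: for `ℓ` prime with
`a_ℓ [r]⁺ = Σ_{j<ℓ} [(r+j)/ℓ]⁺ + [ℓr]⁺`, and `b ∈ ℤ/m'`,
`Σ_{a ∈ ℤ/m'ℓ, a ≡ b (m')} [a/m'ℓ]⁺ = a_ℓ [b/m']⁺ − [ℓ b/m']⁺` (all residues `a`, units or not)
(Mazur–Tate–Teitelbaum 1986, §I.4 (4.2); Mazur–Tate 1987, §1.3). [cite: MazurTate1987, §1.3] -/
theorem deltaParity_sum_fiber_symbol (hℓ : ℓ.Prime) {aℓ : ℤ}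
    (hhecke : ∀ r : ℚ, (aℓ : ℚ) * ratPlusSymbol f r =
      ∑ j : Fin ℓ, ratPlusSymbol f ((r + ((j : ℕ) : ℚ)) / ℓ) + ratPlusSymbol f (ℓ * r))
    (b : ZMod m') :
    ∑ a ∈ Finset.univ.filter (fun a : ZMod (m' * ℓ) ↦ (a.cast : ZMod m') = b),
        ratPlusSymbol f (((a.val : ℕ) : ℚ) / ((m' * ℓ : ℕ) : ℚ)) =
      aℓ * ratPlusSymbol f (((b.val : ℕ) : ℚ) / m') -
        ratPlusSymbol f (((ℓ * b.val : ℕ) : ℚ) / m') := by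
  rw [deltaParity_sum_filter_cast_eq]
  set x : ℚ := ((b.val : ℕ) : ℚ) / m' with hx
  have hm' : (m' : ℚ) ≠ 0 := by exact_mod_cast NeZero.ne m'
  have hℓ0 : (ℓ : ℚ) ≠ 0 := by exact_mod_cast hℓ.ne_zero
  have hA : ∀ j : Fin ℓ,
      ratPlusSymbol f ((((((b.val + m' * (j : ℕ) : ℕ) : ZMod (m' * ℓ))).val : ℕ) : ℚ) /
        ((m' * ℓ : ℕ) : ℚ)) = ratPlusSymbol f ((x + ((j : ℕ) : ℚ)) / ℓ) := by
    intro j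
    rw [deltaParity_val_classLift]
    congr 1
    rw [hx]
    push_cast
    field_simp
  have hB : ratPlusSymbol f (((ℓ * b.val : ℕ) : ℚ) / m') = ratPlusSymbol f (ℓ * x) := by
    congr 1
    rw [hx]
    push_cast
    ring
  simp only [hA]
  rw [hB, eq_sub_iff_add_eq, ← hhecke x]

omit [Fact p.Prime] in
/-- **The norm relation for units** (Mazur–Tate 1987, §1.3: the image of the modular element
`θ_{m'ℓ}` in `ℚ[(ℤ/m')ˣ]` is `(a_ℓ − σ_ℓ − σ_ℓ⁻¹) θ_{m'}`): for `ℓ ∤ m'` prime with the Hecke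
relation and `b ∈ (ℤ/m')ˣ`,
`Σ_{a ∈ (ℤ/m'ℓ)ˣ, a ≡ b (m')} [a/m'ℓ]⁺ = a_ℓ [b/m']⁺ − [ℓb/m']⁺ − [ℓ⁻¹b/m']⁺`
(the fibre over `b` minus its unique non-unit `ℓ·(ℓ⁻¹ b)`, whose symbol is `[ℓ⁻¹b/m']⁺`).
[cite: MazurTate1987, §1.3] -/
theorem deltaParity_sum_unitFiber_symbol [NeZero N] (hℓ : ℓ.Prime) (hcop : ℓ.Coprime m') {aℓ : ℤ}
    (hhecke : ∀ r : ℚ, (aℓ : ℚ) * ratPlusSymbol f r =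
      ∑ j : Fin ℓ, ratPlusSymbol f ((r + ((j : ℕ) : ℚ)) / ℓ) + ratPlusSymbol f (ℓ * r))
    (b : (ZMod m')ˣ) :
    ∑ u ∈ Finset.univ.filter
        (fun u : (ZMod (m' * ℓ))ˣ ↦ ZMod.unitsMap (dvd_mul_right m' ℓ) u = b),
        ratPlusSymbol f ((((u : ZMod (m' * ℓ)).val : ℕ) : ℚ) / ((m' * ℓ : ℕ) : ℚ)) =
      aℓ * ratPlusSymbol f ((((b : ZMod m').val : ℕ) : ℚ) / m') -
        ratPlusSymbol f ((((↑(ZMod.unitOfCoprime ℓ hcop * b) : ZMod m').val : ℕ) : ℚ) / m') -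
        ratPlusSymbol f ((((↑((ZMod.unitOfCoprime ℓ hcop)⁻¹ * b) : ZMod m').val : ℕ) : ℚ) /
          m') := by
  haveI : Fact ℓ.Prime := ⟨hℓ⟩
  set L := ZMod.unitOfCoprime ℓ hcop with hL
  set c : ZMod m' := ↑(L⁻¹ * b) with hc
  set a₀ : ZMod (m' * ℓ) := ((ℓ * c.val : ℕ) : ZMod (m' * ℓ)) with ha₀
  set F : ZMod (m' * ℓ) → ℚ := fun a ↦ ratPlusSymbol f (((a.val : ℕ) : ℚ) / ((m' * ℓ : ℕ) : ℚ))
    with hF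
  set T := Finset.univ.filter (fun a : ZMod (m' * ℓ) ↦ (a.cast : ZMod m') = b) with hT
  -- (i) the sum over units of the fibre, as a sum over classes
  have hset : (Finset.univ.filter
      (fun u : (ZMod (m' * ℓ))ˣ ↦ ZMod.unitsMap (dvd_mul_right m' ℓ) u = b)).map
        ⟨Units.val, Units.val_injective⟩ = T.filter IsUnit := by
    ext a
    simp only [Finset.mem_map, Finset.mem_filter, Finset.mem_univ, true_and,
      Function.Embedding.coeFn_mk, hT]
    constructor
    · rintro ⟨u, hu, rfl⟩
      exact ⟨by rw [← hu, ZMod.unitsMap_val], u.isUnit⟩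
    · rintro ⟨ha, hu⟩
      refine ⟨hu.unit, Units.ext ?_, hu.unit_spec⟩
      rw [ZMod.unitsMap_val, hu.unit_spec, ha]
  have hi : ∑ u ∈ Finset.univ.filter
      (fun u : (ZMod (m' * ℓ))ˣ ↦ ZMod.unitsMap (dvd_mul_right m' ℓ) u = b), F u =
      ∑ a ∈ T.filter IsUnit, F a := by
    rw [← hset, Finset.sum_map]
    rfl
  -- (ii) the unique non-unit of the fibre
  have ha₀c : (a₀.cast : ZMod m') = (b : ZMod m') := by
    rw [ha₀, ZMod.cast_natCast (dvd_mul_right m' ℓ), Nat.cast_mul, ZMod.natCast_zmod_val, hc,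
      ← ZMod.coe_unitOfCoprime ℓ hcop, ← hL, ← Units.val_mul, mul_inv_cancel_left]
  have ha₀ℓ : (a₀.cast : ZMod ℓ) = 0 := by
    rw [ha₀, ZMod.cast_natCast (dvd_mul_left ℓ m'), Nat.cast_mul, ZMod.natCast_self, zero_mul]
  have ha₀u : ¬ IsUnit a₀ := by
    intro h
    have h' := h.map (ZMod.castHom (dvd_mul_left ℓ m') (ZMod ℓ))
    rw [ZMod.castHom_apply, ha₀ℓ, isUnit_zero_iff] at h'
    exact zero_ne_one h'
  have hsingle : T.filter (fun a ↦ ¬ IsUnit a) = {a₀} := by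
    ext a
    simp only [Finset.mem_filter, Finset.mem_univ, true_and, Finset.mem_singleton, hT]
    constructor
    · rintro ⟨hab, hau⟩
      have haℓ : (a.cast : ZMod ℓ) = 0 := by
        by_contra hne
        exact hau (deltaParity_isUnit_of_cast a (hab ▸ b.isUnit) (isUnit_iff_ne_zero.mpr hne))
      exact deltaParity_eq_of_cast_eq hcop a a₀ (hab.trans ha₀c.symm) (haℓ.trans ha₀ℓ.symm)
    · rintro rfl
      exact ⟨ha₀c, ha₀u⟩
  -- (iii) its symbol, and the symbol `[ℓ b / m']`
  have hval₀ : F a₀ = ratPlusSymbol f (((c.val : ℕ) : ℚ) / m') := by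
    have hlt : ℓ * c.val < m' * ℓ := by
      rw [mul_comm m' ℓ]
      exact Nat.mul_lt_mul_of_pos_left (ZMod.val_lt c) hℓ.pos
    simp only [hF, ha₀]
    rw [ZMod.val_natCast_of_lt hlt]
    congr 1
    push_cast
    rw [mul_comm (ℓ : ℚ) _, mul_div_mul_right _ _ (by exact_mod_cast hℓ.ne_zero)]
  have hLb : ratPlusSymbol f (((ℓ * (b : ZMod m').val : ℕ) : ℚ) / m') =
      ratPlusSymbol f ((((↑(L * b) : ZMod m').val : ℕ) : ℚ) / m') := by
    rw [← deltaParity_symbol_natCast f, Nat.cast_mul, ZMod.natCast_zmod_val, Units.val_mul, hL,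
      ZMod.coe_unitOfCoprime]
  -- assemble
  have hsplit := Finset.sum_filter_add_sum_filter_not T IsUnit F
  rw [hsingle, Finset.sum_singleton, hT, deltaParity_sum_fiber_symbol f hℓ hhecke (b : ZMod m'),
    ← hT, hval₀, hLb] at hsplit
  change ∑ u ∈ Finset.univ.filter
      (fun u : (ZMod (m' * ℓ))ˣ ↦ ZMod.unitsMap (dvd_mul_right m' ℓ) u = b), F u = _
  rw [hi]
  linear_combination hsplit

/-- **The norm relation modulo `p^k` at a Kolyvagin prime** (`a_ℓ ≡ 2`): with `p`-integral
symbols, `Σ_{a ∈ (ℤ/m'ℓ)ˣ, a ≡ b (m')} \overline{[a/m'ℓ]⁺} =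
2\overline{[b/m']⁺} − \overline{[ℓb/m']⁺} − \overline{[ℓ⁻¹b/m']⁺}` in `ℤ/p^k`
(Kim 2022, §3; Mazur–Tate 1987, §1.3). [cite: MazurTate1987, §1.3] -/
theorem deltaParity_sum_unitFiber_ratModP [NeZero N] (hℓ : ℓ.Prime) (hcop : ℓ.Coprime m') {aℓ : ℤ}
    (haℓ : (aℓ : ZMod (p ^ k)) = 2)
    (hhecke : ∀ r : ℚ, (aℓ : ℚ) * ratPlusSymbol f r =
      ∑ j : Fin ℓ, ratPlusSymbol f ((r + ((j : ℕ) : ℚ)) / ℓ) + ratPlusSymbol f (ℓ * r))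
    (hint : ∀ z : ℕ, ‖((ratPlusSymbol f ((z : ℚ) / ((m' * ℓ : ℕ) : ℚ)) : ℚ) : ℚ_[p])‖ ≤ 1)
    (hint' : ∀ z : ℕ, ‖((ratPlusSymbol f ((z : ℚ) / m') : ℚ) : ℚ_[p])‖ ≤ 1)
    (b : (ZMod m')ˣ) :
    ∑ u ∈ Finset.univ.filter
        (fun u : (ZMod (m' * ℓ))ˣ ↦ ZMod.unitsMap (dvd_mul_right m' ℓ) u = b),
        ratModP (p ^ k)
          (ratPlusSymbol f ((((u : ZMod (m' * ℓ)).val : ℕ) : ℚ) / ((m' * ℓ : ℕ) : ℚ))) =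
      2 * ratModP (p ^ k) (ratPlusSymbol f ((((b : ZMod m').val : ℕ) : ℚ) / m')) -
        ratModP (p ^ k) (ratPlusSymbol f
          ((((↑(ZMod.unitOfCoprime ℓ hcop * b) : ZMod m').val : ℕ) : ℚ) / m')) -
        ratModP (p ^ k) (ratPlusSymbol f
          ((((↑((ZMod.unitOfCoprime ℓ hcop)⁻¹ * b) : ZMod m').val : ℕ) : ℚ) / m')) := by
  rw [← deltaParity_ratModP_sum k _ (fun u _ ↦ hint _),
    deltaParity_sum_unitFiber_symbol f hℓ hcop hhecke b,
    deltaParity_ratModP_mul_sub_sub k aℓ (hint' _) (hint' _) (hint' _), haℓ]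

end NormRelation

/-! ### Incomplete Kurihara sums vanish (Kim 2022, proof of Prop. 3.16) -/

section Incomplete

variable {p : ℕ} [Fact p.Prime] (k : ℕ) {N : ℕ} [NeZero N] (f : CuspForm (Gamma0 N) 2)
  (Λ : (ℓ : ℕ) → ZMod ℓ → ZMod (p ^ k))
  (hΛ : ∀ {ℓ m : ℕ}, ℓ ∣ m → ∀ u v : (ZMod m)ˣ,
    Λ ℓ ((↑(u * v) : ZMod m).cast) = Λ ℓ ((u : ZMod m).cast) + Λ ℓ ((v : ZMod m).cast))

include hΛ

/-- **Recursion for the incomplete sums**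
`D(m, S) = Σ_{a ∈ (ℤ/m)ˣ} \overline{[a/m]⁺} Π_{q∈S} Λ_q(a)`:
for `m = m'ℓ`, `ℓ ∤ m'` a prime with `a_ℓ ≡ 2 (mod p^k)` and `S` a set of primes dividing `m'`,
`D(m'ℓ, S) = 2 D(m', S) − Σ_{T ⊆ S} (Π_{S∖T} (−e_q)) D(m', T) − Σ_{T ⊆ S} (Π_{S∖T} e_q) D(m', T)`,
`e_q = Λ_q(ℓ)`: fibre the sum over `(ℤ/m'ℓ)ˣ → (ℤ/m')ˣ`, apply the norm relation, reindex by
`b ↦ ℓ^{±1} b` and expand `Π (Λ_q(b) ± e_q)` (Kim 2022, §3.5; Mazur–Tate 1987, §1.3).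
[cite: Kim2022StructureSelmer, Prop. 3.16] -/
theorem deltaParity_incompleteSum_mul {m' ℓ : ℕ} [NeZero m'] [NeZero ℓ] (hℓ : ℓ.Prime)
    (hcop : ℓ.Coprime m') {aℓ : ℤ} (haℓ : (aℓ : ZMod (p ^ k)) = 2)
    (hhecke : ∀ r : ℚ, (aℓ : ℚ) * ratPlusSymbol f r =
      ∑ j : Fin ℓ, ratPlusSymbol f ((r + ((j : ℕ) : ℚ)) / ℓ) + ratPlusSymbol f (ℓ * r))
    (hint : ∀ z : ℕ, ‖((ratPlusSymbol f ((z : ℚ) / ((m' * ℓ : ℕ) : ℚ)) : ℚ) : ℚ_[p])‖ ≤ 1)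
    (hint' : ∀ z : ℕ, ‖((ratPlusSymbol f ((z : ℚ) / m') : ℚ) : ℚ_[p])‖ ≤ 1)
    {S : Finset ℕ} (hS : ∀ q ∈ S, q ∣ m') :
    ∑ u : (ZMod (m' * ℓ))ˣ, ratModP (p ^ k)
        (ratPlusSymbol f ((((u : ZMod (m' * ℓ)).val : ℕ) : ℚ) / ((m' * ℓ : ℕ) : ℚ))) *
        ∏ q ∈ S, Λ q ((u : ZMod (m' * ℓ)).cast) =
      2 * ∑ c : (ZMod m')ˣ, ratModP (p ^ k)
          (ratPlusSymbol f ((((c : ZMod m').val : ℕ) : ℚ) / m')) *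
          ∏ q ∈ S, Λ q ((c : ZMod m').cast) -
      ∑ T ∈ S.powerset,
        (∏ q ∈ S \ T, -Λ q ((↑(ZMod.unitOfCoprime ℓ hcop) : ZMod m').cast)) *
          ∑ c : (ZMod m')ˣ, ratModP (p ^ k)
            (ratPlusSymbol f ((((c : ZMod m').val : ℕ) : ℚ) / m')) *
            ∏ q ∈ T, Λ q ((c : ZMod m').cast) -
      ∑ T ∈ S.powerset,
        (∏ q ∈ S \ T, Λ q ((↑(ZMod.unitOfCoprime ℓ hcop) : ZMod m').cast)) *
          ∑ c : (ZMod m')ˣ, ratModP (p ^ k)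
            (ratPlusSymbol f ((((c : ZMod m').val : ℕ) : ℚ) / m')) *
            ∏ q ∈ T, Λ q ((c : ZMod m').cast) := by
  obtain ⟨L, hL⟩ : ∃ L : (ZMod m')ˣ, L = ZMod.unitOfCoprime ℓ hcop := ⟨_, rfl⟩
  have hdvd : m' ∣ m' * ℓ := dvd_mul_right m' ℓ
  obtain ⟨s, hs⟩ : ∃ s : (ZMod m')ˣ → ZMod (p ^ k), ∀ c, s c =
      ratModP (p ^ k) (ratPlusSymbol f ((((c : ZMod m').val : ℕ) : ℚ) / m')) := ⟨_, fun _ ↦ rfl⟩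
  obtain ⟨wt, hwt⟩ : ∃ wt : (ZMod m')ˣ → ZMod (p ^ k), ∀ c, wt c =
      ∏ q ∈ S, Λ q ((c : ZMod m').cast) := ⟨_, fun _ ↦ rfl⟩
  -- Step 1: fibre over `(ℤ/m')ˣ` and apply the norm relation
  have h1 : ∑ u : (ZMod (m' * ℓ))ˣ, ratModP (p ^ k)
        (ratPlusSymbol f ((((u : ZMod (m' * ℓ)).val : ℕ) : ℚ) / ((m' * ℓ : ℕ) : ℚ))) *
        ∏ q ∈ S, Λ q ((u : ZMod (m' * ℓ)).cast) =
      ∑ b : (ZMod m')ˣ, (2 * s b - s (L * b) - s (L⁻¹ * b)) * wt b := by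
    rw [← Finset.sum_fiberwise Finset.univ (ZMod.unitsMap hdvd)]
    refine Finset.sum_congr rfl fun b _ ↦ ?_
    have hw : ∀ u ∈ Finset.univ.filter (fun u : (ZMod (m' * ℓ))ˣ ↦ ZMod.unitsMap hdvd u = b),
        ratModP (p ^ k)
            (ratPlusSymbol f ((((u : ZMod (m' * ℓ)).val : ℕ) : ℚ) / ((m' * ℓ : ℕ) : ℚ))) *
          ∏ q ∈ S, Λ q ((u : ZMod (m' * ℓ)).cast) =
        ratModP (p ^ k)
            (ratPlusSymbol f ((((u : ZMod (m' * ℓ)).val : ℕ) : ℚ) / ((m' * ℓ : ℕ) : ℚ))) *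
          wt b := fun u hu ↦ by
      rw [hwt, deltaParity_prod_cast_cast Λ hdvd hS, ← ZMod.unitsMap_val hdvd,
        (Finset.mem_filter.mp hu).2]
    rw [Finset.sum_congr rfl hw, ← Finset.sum_mul,
      deltaParity_sum_unitFiber_ratModP k f hℓ hcop haℓ hhecke hint hint' b, ← hL, hs, hs, hs]
  -- Step 2: reindex the shifted sums
  have h2 : ∑ b : (ZMod m')ˣ, s (L * b) * wt b = ∑ c : (ZMod m')ˣ, s c * wt (L⁻¹ * c) :=
    Fintype.sum_equiv (Equiv.mulLeft L) _ _ fun b ↦ by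
      simp only [Equiv.coe_mulLeft, inv_mul_cancel_left]
  have h3 : ∑ b : (ZMod m')ˣ, s (L⁻¹ * b) * wt b = ∑ c : (ZMod m')ˣ, s c * wt (L * c) :=
    Fintype.sum_equiv (Equiv.mulLeft L⁻¹) _ _ fun b ↦ by
      simp only [Equiv.coe_mulLeft, mul_inv_cancel_left]
  have h4 : ∑ b : (ZMod m')ˣ, (2 * s b - s (L * b) - s (L⁻¹ * b)) * wt b =
      2 * ∑ b : (ZMod m')ˣ, s b * wt b - ∑ c : (ZMod m')ˣ, s c * wt (L⁻¹ * c) -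
        ∑ c : (ZMod m')ˣ, s c * wt (L * c) := by
    rw [← h2, ← h3, Finset.mul_sum, ← Finset.sum_sub_distrib, ← Finset.sum_sub_distrib]
    exact Finset.sum_congr rfl fun b _ ↦ by ring
  -- Step 3: expand the shifted weights
  have h5 : ∑ c : (ZMod m')ˣ, s c * wt (L⁻¹ * c) = ∑ T ∈ S.powerset,
      (∏ q ∈ S \ T, -Λ q ((L : ZMod m').cast)) * ∑ c : (ZMod m')ˣ, s c *
        ∏ q ∈ T, Λ q ((c : ZMod m').cast) := by
    rw [← deltaParity_sum_mul_prod_add Λ s S]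
    exact Finset.sum_congr rfl fun c _ ↦ by rw [hwt, deltaParity_prod_cast_inv_mul Λ hΛ hS]
  have h6 : ∑ c : (ZMod m')ˣ, s c * wt (L * c) = ∑ T ∈ S.powerset,
      (∏ q ∈ S \ T, Λ q ((L : ZMod m').cast)) * ∑ c : (ZMod m')ˣ, s c *
        ∏ q ∈ T, Λ q ((c : ZMod m').cast) := by
    rw [← deltaParity_sum_mul_prod_add Λ s S]
    exact Finset.sum_congr rfl fun c _ ↦ by rw [hwt, deltaParity_prod_cast_mul Λ hΛ hS]
  rw [h1, h4, h5, h6, hL]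
  simp only [hs, hwt]

/-- **The incomplete Kurihara sums vanish modulo `p^k`.** Let `n` be square-free, non-zero, with
all symbols `[z/m]⁺_f`, `m ∣ n`, `p`-integral and the Hecke relation with `a_ℓ ≡ 2 (mod p^k)` at
every prime `ℓ ∣ n`. Then for every `m ∣ n` and every PROPER subset `S ⊊ primeFactors m`,
`D(m, S) = Σ_{a ∈ (ℤ/m)ˣ} \overline{[a/m]⁺} Π_{q ∈ S} Λ_q(a mod q) = 0` in `ℤ/p^k`. Strong
induction on `m` with the recursion `deltaParity_incompleteSum_mul` at a prime
`ℓ ∈ primeFactors m ∖ S`: all `D(m/ℓ, T)`, `T ⊊ S`, vanish, and the `T = S` terms cancel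
(`2 − 1 − 1 = 0`). This is the group-ring statement "`θ_m ↦ (a_ℓ − σ_ℓ − σ_ℓ⁻¹)θ_{m/ℓ}` has
vanishing lower Taylor coefficients" of Kim 2022, §3.5 / Prop. 3.16.
[cite: Kim2022StructureSelmer, Prop. 3.16] -/
theorem deltaParity_incompleteSum_eq_zero {n : ℕ} (hn0 : n ≠ 0) (hsq : Squarefree n)
    (hint : ∀ m, m ∣ n → ∀ z : ℤ, ‖((ratPlusSymbol f ((z : ℚ) / m) : ℚ) : ℚ_[p])‖ ≤ 1)
    (hhecke : ∀ ℓ ∈ n.primeFactors, ∃ aℓ : ℤ, (aℓ : ZMod (p ^ k)) = 2 ∧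
      ∀ r : ℚ, (aℓ : ℚ) * ratPlusSymbol f r =
        ∑ j : Fin ℓ, ratPlusSymbol f ((r + ((j : ℕ) : ℚ)) / ℓ) + ratPlusSymbol f (ℓ * r)) :
    ∀ (m : ℕ) [NeZero m], m ∣ n → ∀ S, S ⊂ m.primeFactors →
      ∑ u : (ZMod m)ˣ, ratModP (p ^ k)
          (ratPlusSymbol f ((((u : ZMod m).val : ℕ) : ℚ) / m)) *
          ∏ q ∈ S, Λ q ((u : ZMod m).cast) = 0 := by
  intro m
  induction m using Nat.strong_induction_on with
  | h m ih =>
  intro _ hmn S hS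
  obtain ⟨ℓ, hℓm, hℓS⟩ := Finset.exists_of_ssubset hS
  have hℓ : ℓ.Prime := Nat.prime_of_mem_primeFactors hℓm
  haveI : NeZero ℓ := ⟨hℓ.ne_zero⟩
  obtain ⟨m', rfl⟩ : ∃ m', m = m' * ℓ := by
    obtain ⟨m', hm'⟩ := Nat.dvd_of_mem_primeFactors hℓm
    exact ⟨m', by rw [hm', mul_comm]⟩
  have hcop : ℓ.Coprime m' := (Nat.squarefree_mul_iff.mp (hsq.squarefree_of_dvd hmn)).1.symm
  have hm'0 : m' ≠ 0 := by
    rintro rfl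
    rw [zero_mul] at hmn
    exact hn0 (zero_dvd_iff.mp hmn)
  haveI : NeZero m' := ⟨hm'0⟩
  have hm'n : m' ∣ n := dvd_trans (dvd_mul_right m' ℓ) hmn
  have hS' : S ⊆ m'.primeFactors := by
    intro q hq
    have hq' := hS.1 hq
    rw [Nat.primeFactors_mul hm'0 hℓ.ne_zero, Finset.mem_union, hℓ.primeFactors,
      Finset.mem_singleton] at hq'
    rcases hq' with h | rfl
    · exact h
    · exact absurd hq hℓS
  have hSd : ∀ q ∈ S, q ∣ m' := fun q hq ↦ Nat.dvd_of_mem_primeFactors (hS' hq)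
  obtain ⟨aℓ, haℓ, hheckeℓ⟩ :=
    hhecke ℓ (Nat.mem_primeFactors.mpr ⟨hℓ, dvd_trans (dvd_mul_left ℓ m') hmn, hn0⟩)
  have hlt : m' < m' * ℓ := (Nat.lt_mul_iff_one_lt_right (Nat.pos_of_ne_zero hm'0)).mpr hℓ.one_lt
  have ih' : ∀ T ∈ S.powerset, T ≠ S →
      ∑ u : (ZMod m')ˣ, ratModP (p ^ k)
          (ratPlusSymbol f ((((u : ZMod m').val : ℕ) : ℚ) / m')) *
          ∏ q ∈ T, Λ q ((u : ZMod m').cast) = 0 := fun T hT hTS ↦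
    ih m' hlt hm'n T (Finset.ssubset_of_ssubset_of_subset
      ((Finset.ssubset_iff_subset_ne).mpr ⟨Finset.mem_powerset.mp hT, hTS⟩) hS')
  have hintm : ∀ z : ℕ,
      ‖((ratPlusSymbol f ((z : ℚ) / ((m' * ℓ : ℕ) : ℚ)) : ℚ) : ℚ_[p])‖ ≤ 1 := fun z ↦ by
    have h := hint (m' * ℓ) hmn z
    rwa [Int.cast_natCast] at h
  have hintm' : ∀ z : ℕ, ‖((ratPlusSymbol f ((z : ℚ) / m') : ℚ) : ℚ_[p])‖ ≤ 1 := fun z ↦ by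
    have h := hint m' hm'n z
    rwa [Int.cast_natCast] at h
  rw [deltaParity_incompleteSum_mul k f Λ hΛ hℓ hcop haℓ hheckeℓ hintm hintm' hSd,
    Finset.sum_eq_single_of_mem S (Finset.mem_powerset_self S)
      (fun T hT hTS ↦ by rw [ih' T hT hTS, mul_zero]),
    Finset.sum_eq_single_of_mem S (Finset.mem_powerset_self S)
      (fun T hT hTS ↦ by rw [ih' T hT hTS, mul_zero]),
    Finset.sdiff_self, Finset.prod_empty, Finset.prod_empty]
  ring

end Incomplete

/-- **Registered sub-goal `stub_delta_parity_incompleteSum_eq_zero`** (support file II of stub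
V1): the incomplete Kurihara sums over `S ⊊ primeFactors m`, `m ∣ n` square-free, vanish in
`ℤ/p^k` for every logarithm-like `Λ` (closed restatement of `deltaParity_incompleteSum_eq_zero`;
Kim 2022, proof of Prop. 3.16). [cite: Kim2022StructureSelmer, Prop. 3.16] -/
theorem stub_delta_parity_incompleteSum_eq_zero :
    ∀ (p : ℕ) [Fact p.Prime] (k N : ℕ) [NeZero N] (f : CuspForm (CongruenceSubgroup.Gamma0 N) 2)
      (Λ : (ℓ : ℕ) → ZMod ℓ → ZMod (p ^ k)),
      (∀ {ℓ m : ℕ}, ℓ ∣ m → ∀ u v : (ZMod m)ˣ, Λ ℓ ((↑(u * v) : ZMod m).cast) =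
        Λ ℓ ((u : ZMod m).cast) + Λ ℓ ((v : ZMod m).cast)) →
      ∀ (n : ℕ), n ≠ 0 → Squarefree n →
        (∀ m, m ∣ n → ∀ z : ℤ,
          ‖((Literature.NumberTheory.EllipticCurves.ratPlusSymbol f ((z : ℚ) / m) : ℚ) :
            ℚ_[p])‖ ≤ 1) →
        (∀ ℓ ∈ n.primeFactors, ∃ aℓ : ℤ, (aℓ : ZMod (p ^ k)) = 2 ∧ ∀ r : ℚ,
          (aℓ : ℚ) * Literature.NumberTheory.EllipticCurves.ratPlusSymbol f r =
            ∑ j : Fin ℓ, Literature.NumberTheory.EllipticCurves.ratPlusSymbol f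
              ((r + ((j : ℕ) : ℚ)) / ℓ) +
              Literature.NumberTheory.EllipticCurves.ratPlusSymbol f (ℓ * r)) →
        ∀ (m : ℕ) [NeZero m], m ∣ n → ∀ S, S ⊂ m.primeFactors →
          ∑ u : (ZMod m)ˣ, Literature.NumberTheory.DiophantineGeometry.Dioph.ratModP (p ^ k)
              (Literature.NumberTheory.EllipticCurves.ratPlusSymbol f
                ((((u : ZMod m).val : ℕ) : ℚ) / m)) *
            ∏ q ∈ S, Λ q ((u : ZMod m).cast) = 0 :=
  fun _ _ k _ _ f Λ hΛ _ hn0 hsq hint hhecke m _ hmn S hS ↦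
    deltaParity_incompleteSum_eq_zero k f Λ hΛ hn0 hsq hint hhecke m hmn S hS

end Summit.BirchSwinnertonDyer.BirchSwinnertonDyer.Theorems

end
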